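import Literature.AlgebraicGeometry.Resolution.LogRegularAbsorbedChart
import HarnessLib

/-!
# Kato 1994, (10.3) at the closed point with `d` regular parameters

`Literature/AlgebraicGeometry/Resolution/LogRegularRefinementAbsorb.lean`. K. Kato, *Toric
singularities*, Amer. J. Math. 116 (1994), (10.3), for a log regular local ring `A` with chart
`φ : P → A` and `A/I(φ)` regular of dimension `d` (`dim A = rank P + d`, `𝔪_A = I(φ) + (t₁,…,t_d)`):
by absorbing the parameters into the chart (`LogRegularAbsorbedChart.lean`: `P̃ = P × ℕ^d`,
`rank P̃ = rank P + d`, proved here) the `d = 0` theorem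
`isRegularLocalRing_localization_closedPoint_of_isNoetherianRing` gives: the local ring at
`(𝔪_A, T, T′)` of `A[T₁..T_N, T′₁..T′_d]/(φ(p) t^e − T^{c p} T′^e)` is regular of dimension `N + d`.

* `rank_absorbMonoid` — `rank (P × ℕ^d) = rank P + d`;
* `isRegularLocalRing_localization_closedPoint_absorb` — the regularity statement.

References: [Kato1994] K. Kato, Toric singularities, Amer. J. Math. 116 (1994), (2.1), (3.2), (10.3).
-/

noncomputable section

open IsLocalRing Literature.RingTheory.MvPowerSeries
  Literature.RingTheory.MvPowerSeries.monoidPowerSeries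

namespace Literature.AlgebraicGeometry.Resolution

namespace LogRegularCompleteStructure

universe u

/-! ### The rank of the absorbed monoid -/

section Rank

variable {M d : ℕ}

/-- Splitting `ℚ^{M+d} = ℚ^M × ℚ^d` (linear, injective). [folklore] -/
private def splitQ (M d : ℕ) : (Fin (M + d) → ℚ) →ₗ[ℚ] (Fin M → ℚ) × (Fin d → ℚ) :=
  (LinearMap.funLeft ℚ ℚ (Fin.castAdd d)).prod (LinearMap.funLeft ℚ ℚ (Fin.natAdd M))

/-- Bookkeeping for the absorbed chart `P × ℕ^d`. [cite: Kato1994, (3.2)] -/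
private theorem splitQ_injective : Function.Injective (splitQ M d) := by
  intro v w h
  have h1 : ∀ i : Fin M, v (Fin.castAdd d i) = w (Fin.castAdd d i) :=
    fun i => congrFun (congrArg Prod.fst h) i
  have h2 : ∀ k : Fin d, v (Fin.natAdd M k) = w (Fin.natAdd M k) :=
    fun k => congrFun (congrArg Prod.snd h) k
  funext j
  induction j using Fin.addCases with
  | left i => exact h1 i
  | right k => exact h2 k

/-- Bookkeeping for the absorbed chart `P × ℕ^d`. [cite: Kato1994, (3.2)] -/
private theorem splitQ_toRatVec (w : Fin (M + d) →₀ ℕ) :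
    splitQ M d (toRatVec w) = (toRatVec (absorbProj₁ M d w), toRatVec (absorbProj₂ M d w)) :=
  Prod.ext (funext fun _ => rfl) (funext fun _ => rfl)

/-- The span of a product of sets containing `0` is the product of the spans. [folklore] -/
private theorem span_prod_eq {V W : Type*} [AddCommGroup V] [Module ℚ V] [AddCommGroup W]
    [Module ℚ W] {s : Set V} {t : Set W} (hs : (0 : V) ∈ s) (ht : (0 : W) ∈ t) :
    Submodule.span ℚ (s ×ˢ t) = (Submodule.span ℚ s).prod (Submodule.span ℚ t) := by
  refine le_antisymm (Submodule.span_prod_le s t) ?_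
  rintro ⟨x, y⟩ ⟨hx, hy⟩
  have h1 : (x, (0 : W)) ∈ Submodule.span ℚ (s ×ˢ t) := by
    have : (Submodule.span ℚ s).map (LinearMap.inl ℚ V W) ≤ Submodule.span ℚ (s ×ˢ t) := by
      rw [Submodule.map_span]
      exact Submodule.span_mono (by rintro _ ⟨a, ha, rfl⟩; exact ⟨ha, ht⟩)
    exact this ⟨x, hx, rfl⟩
  have h2 : ((0 : V), y) ∈ Submodule.span ℚ (s ×ˢ t) := by
    have : (Submodule.span ℚ t).map (LinearMap.inr ℚ V W) ≤ Submodule.span ℚ (s ×ˢ t) := by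
      rw [Submodule.map_span]
      exact Submodule.span_mono (by rintro _ ⟨b, hb, rfl⟩; exact ⟨hs, hb⟩)
    exact this ⟨y, hy, rfl⟩
  have := Submodule.add_mem _ h1 h2
  rwa [Prod.mk_add_mk, add_zero, zero_add] at this

/-- A product of submodules is linearly equivalent to the product module. [folklore] -/
private def prodSubmoduleEquiv {V W : Type*} [AddCommGroup V] [Module ℚ V] [AddCommGroup W]
    [Module ℚ W] (p : Submodule ℚ V) (q : Submodule ℚ W) : (p.prod q) ≃ₗ[ℚ] p × q where
  toFun x := (⟨x.1.1, x.2.1⟩, ⟨x.1.2, x.2.2⟩)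
  invFun y := ⟨(y.1.1, y.2.1), ⟨y.1.2, y.2.2⟩⟩
  map_add' _ _ := rfl
  map_smul' _ _ := rfl
  left_inv _ := rfl
  right_inv _ := rfl

/-- `ℚ^d` is spanned by the images of the exponent vectors. [folklore] -/
private theorem span_range_toRatVec_eq_top (d : ℕ) :
    Submodule.span ℚ (Set.range (toRatVec (σ := Fin d))) = ⊤ := by
  refine eq_top_iff.2 ?_
  rw [← (Pi.basisFun ℚ (Fin d)).span_eq]
  refine Submodule.span_mono ?_
  rintro _ ⟨k, rfl⟩
  refine ⟨Finsupp.single k 1, ?_⟩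
  funext j
  rw [Pi.basisFun_apply, toRatVec_apply, Finsupp.single_apply, Pi.single_apply]
  split_ifs with h1 h2 h2
  · rfl
  · exact (h2 h1.symm).elim
  · exact (h1 h2.symm).elim
  · rfl

/-- **`rank (P × ℕ^d) = rank P + d`.** [cite: Kato1994, (3.2)] -/
theorem rank_absorbMonoid (P : AddSubmonoid (Fin M →₀ ℕ)) (d : ℕ) :
    rank (absorbMonoid P d) = rank P + d := by
  classical
  unfold rank
  set V := Submodule.span ℚ (toRatVec '' (absorbMonoid P d : Set (Fin (M + d) →₀ ℕ))) with hV
  have h1 : Module.finrank ℚ V = Module.finrank ℚ (V.map (splitQ M d)) :=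
    (LinearEquiv.finrank_eq (Submodule.equivMapOfInjective _ splitQ_injective V))
  rw [h1, hV, Submodule.map_span]
  have himage : splitQ M d '' (toRatVec '' (absorbMonoid P d : Set (Fin (M + d) →₀ ℕ))) =
      (toRatVec '' (P : Set (Fin M →₀ ℕ))) ×ˢ Set.range (toRatVec (σ := Fin d)) := by
    ext ⟨x, y⟩
    simp only [Set.mem_image, Set.mem_prod, Set.mem_range, exists_exists_and_eq_and,
      splitQ_toRatVec, Prod.mk.injEq, SetLike.mem_coe, mem_absorbMonoid]
    constructor
    · rintro ⟨w, hw, rfl, rfl⟩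
      exact ⟨⟨_, hw, rfl⟩, ⟨_, rfl⟩⟩
    · rintro ⟨⟨p, hp, rfl⟩, ⟨e, rfl⟩⟩
      exact ⟨absorbGlue M d (p, e), by rw [absorbProj₁_absorbGlue]; exact hp,
        by rw [absorbProj₁_absorbGlue], by rw [absorbProj₂_absorbGlue]⟩
  have hs0 : (0 : Fin M → ℚ) ∈ toRatVec '' (P : Set (Fin M →₀ ℕ)) := ⟨0, zero_mem P, map_zero _⟩
  have ht0 : (0 : Fin d → ℚ) ∈ Set.range (toRatVec (σ := Fin d)) := ⟨0, map_zero _⟩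
  rw [himage, span_prod_eq hs0 ht0,
    LinearEquiv.finrank_eq (prodSubmoduleEquiv _ _), Module.finrank_prod,
    span_range_toRatVec_eq_top, finrank_top, Module.finrank_fin_fun]

end Rank

/-! ### Kato (10.3) at the closed point, general `d` -/

section Regular

variable {A : Type u} [CommRing A] [IsLocalRing A] [IsNoetherianRing A] {M N d : ℕ}
  {P : AddSubmonoid (Fin M →₀ ℕ)} {φ : (Fin M →₀ ℕ) → A} {c : (Fin M →₀ ℕ) → (Fin N →₀ ℕ)}
  {t : Fin d → A}

/-- **Kato 1994, Thm. (10.3) at the closed point, with `d` regular parameters.** Let `A` be a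
Noetherian local ring with a chart `φ : P → A` (`P ⊆ ℕ^{(M)}` finitely generated,
`φ(P ∖ 0) ⊆ 𝔪_A`) and `t₁, …, t_d ∈ 𝔪_A` such that `𝔪_A = (φ(P ∖ 0)) + (t)` and
`dim A = rank P + d` (log regularity at the closed point, Kato (2.1), with a regular system of
parameters `t̄` of `A/I(φ)`), and let `c : P → ℕ^N` be additive with `c⁻¹(0) = 0` and finite
fibres. Then the local ring at `𝔔̃ = (𝔪_A, T, T′)` of the refined chart of the absorbed chart,
`A[T₁..T_N, T′₁..T′_d]/(φ(p)t^e − T^{c p}T′^e)`, is regular of dimension `N + d`.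
[cite: Kato1994, (10.3)] -/
theorem isRegularLocalRing_localization_closedPoint_absorb (hP : P.FG)
    (hφ0 : φ 0 = 1) (hφadd : ∀ a ∈ P, ∀ b ∈ P, φ (a + b) = φ a * φ b)
    (hφm : ∀ p ∈ P, p ≠ 0 → φ p ∈ maximalIdeal A) (ht : ∀ k, t k ∈ maximalIdeal A)
    (hgen : maximalIdeal A ≤ Ideal.span (φ '' {p | p ∈ P ∧ p ≠ 0}) ⊔ Ideal.span (Set.range t))
    (hdim : ringKrullDim A = (rank P + d : ℕ))
    (hc0 : c 0 = 0) (hadd : ∀ a ∈ P, ∀ b ∈ P, c (a + b) = c a + c b)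
    (hc : ∀ p ∈ P, p ≠ 0 → c p ≠ 0)
    (hfin : ∀ e : Fin N →₀ ℕ, {p : Fin M →₀ ℕ | p ∈ P ∧ c p = e}.Finite) :
    letI := isMaximal_closedPoint (P := absorbMonoid P d) (absorbChart_zero hφ0 t)
      (absorbChart_mem_maximalIdeal hφm ht) (absorbMap_zero (d := d) hc0)
      (absorbMap_ne_zero hc)
    IsRegularLocalRing (Localization.AtPrime (closedPoint (absorbChart φ t) (absorbMap c)
        (absorbMonoid P d) (absorbChart_zero hφ0 t) (absorbChart_mem_maximalIdeal hφm ht)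
        (absorbMap_zero (d := d) hc0) (absorbMap_ne_zero hc))) ∧
      ringKrullDim (Localization.AtPrime (closedPoint (absorbChart φ t) (absorbMap c)
        (absorbMonoid P d) (absorbChart_zero hφ0 t) (absorbChart_mem_maximalIdeal hφm ht)
        (absorbMap_zero (d := d) hc0) (absorbMap_ne_zero hc))) = (N + d : ℕ) :=
  isRegularLocalRing_localization_closedPoint_of_isNoetherianRing (absorbChart_zero hφ0 t)
    (absorbChart_mem_maximalIdeal hφm ht) (absorbMap_zero (d := d) hc0)
    (absorbMap_ne_zero hc) (absorbMonoid_fg hP) (absorbChart_add hφadd t)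
    (maximalIdeal_le_span_absorbChart hφ0 hgen) (by rw [hdim, rank_absorbMonoid])
    (absorbMap_add hadd) (absorbMap_finite_fibre hfin)

end Regular

end LogRegularCompleteStructure

end Literature.AlgebraicGeometry.Resolution
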